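import Literature.RepresentationTheory.TwistedCoinvariants
import Literature.NumberTheory.Automorphic.SmoothRepresentation
import Mathlib.GroupTheory.Index
import Mathlib.Topology.Algebra.OpenSubgroup
import HarnessLib

/-!
# An eigenvector of a compact group survives in the twisted coinvariants

Topic `RepresentationTheory`; namespace `Literature.RepresentationTheory.TwistedCoinv` (continuing
`TwistedCoinvariants`).  KERNEL ONLY: theorems, 0 definitions, 0 records, 0 named facts, 0 sorry.

For a representation `ρ : Representation k H S` of a group `H` on a `k`-module `S` (`k` a field of characteristic `0`)
and a character `χ : H →* kˣ`, the `χ`-coinvariants `Coinv ρ χ = S ⧸ span {ρ h w - χ h • w}` (`TwistedCoinvariants`)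
are the maximal quotient on which `H` acts through `χ`.  A `(H, χ)`-EIGENVECTOR `v` (`ρ h v = χ h • v` for all `h`)
need not survive in `Coinv ρ χ` in general (e.g. `H = ℤ` acting on `k[ℤ]`); it DOES when `H` is COMPACT, `ρ` is
SMOOTH (open stabilisers) and `χ` has open kernel — the classical fact that for compact groups the `χ`-isotypic
quotient and the `χ`-isotypic subspace agree ([BernsteinZelevinsky1976, §2.1–2.3]: coinvariants `V_{H,χ}` of a smooth
representation of a compact totally disconnected group; [MoeglinVignerasWaldspurger1987, Chap. 2 II.2]).

* §1 (algebra) `mk_ne_zero_of_eigenvector_of_forall_exists_normal` — if every vector of `S` is fixed by some NORMAL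
  subgroup of FINITE INDEX contained in `ker χ`, then a non-zero `(H, χ)`-eigenvector has non-zero class in
  `Coinv ρ χ`.  Proof: a relation `v = Σ_j c_j (ρ h_j w_j - χ h_j • w_j)` involves finitely many `w_j`; average over
  `H ⧸ N` for a normal finite-index `N` fixing all `w_j` and contained in `ker χ`: the operator
  `A = Σ_{q ∈ H/N} χ(q̃)⁻¹ ρ(q̃)` kills every `ρ h w_j - χ h • w_j` (reindex `q ↦ q h`) and multiplies `v` by `[H : N]`.
* §2 (topology) **`mk_ne_zero_of_eigenvector`** — `H` a compact topological group, `ρ` smooth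
  (`Representation.IsSmooth`, tree `SmoothRepresentation`), `ker χ` open: `v ≠ 0`, `ρ h v = χ h • v` ⇒ `mk ρ χ v ≠ 0`
  (open subgroups of a compact group have finite index, and contain a normal open subgroup of finite index — the normal
  core); the invariant-vector case `mk_ne_zero_of_mem_invariants` (`χ` trivial on `H`, `v` fixed).

Consumer: the «survival of the unramified vector» clause of [Liu2021, Def. 4.11] (`⊗'_v ω(μ_v, ε_v, χ_v)`) at the
places where the centre `U(1)(F_v) = E_v¹` is compact (non-split `v`): there `1_{𝒪_vⁿ}` is fixed by the centre and
`χ_v` is unramified for almost all `v`, so its class in the `χ_v`-coinvariants is non-zero by §2.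

## References
* [BernsteinZelevinsky1976] I. N. Bernstein, A. V. Zelevinsky, *Representations of the group GL(n, F) where F is a
  non-archimedean local field*, Russian Math. Surveys 31 (1976), §2.1–2.3 (smooth representations of l-groups,
  coinvariants under compact subgroups).
* [MoeglinVignerasWaldspurger1987] C. Mœglin, M.-F. Vignéras, J.-L. Waldspurger, LNM 1291 (1987), Chap. 2 II.2.
* [Liu2021] Y. Liu, Camb. J. Math. 9 (2021), Def. 4.11 (FJcycle.tex l. 2092–2096), App. D Step 3 (l. 5221).
-/

set_option autoImplicit false

noncomputable section

open scoped BigOperators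

namespace Literature.RepresentationTheory.TwistedCoinv

/-! ## §1. Algebra: averaging over a finite quotient -/

section Algebra

variable {k : Type*} [Field k] {H : Type*} [Group H] {S : Type*} [AddCommGroup S] [Module k S]
  (ρ : Representation k H S) (χ : H →* kˣ)

/-- on a `(H, χ)`-eigenvector the averaging sum `Σ_{q ∈ H/N} χ(q̃)⁻¹ • ρ(q̃) v` (`q̃ = q.out`) is `[H : N] • v`.
(Private step of the averaging argument.) [folklore] -/
private theorem sum_apply_of_eigenvector (N : Subgroup H) [Fintype (H ⧸ N)] {v : S}
    (hv : ∀ h : H, ρ h v = ((χ h : kˣ) : k) • v) :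
    ∑ q : H ⧸ N, (((χ q.out)⁻¹ : kˣ) : k) • ρ q.out v = (Fintype.card (H ⧸ N) : k) • v := by
  have hterm : ∀ q : H ⧸ N, (((χ q.out)⁻¹ : kˣ) : k) • ρ q.out v = v := fun q => by
    rw [hv, smul_smul, ← Units.val_mul, inv_mul_cancel, Units.val_one, one_smul]
  simp only [hterm, Finset.sum_const, Finset.card_univ, Nat.cast_smul_eq_nsmul]

/-- the averaging sum intertwines `ρ h` with `χ h` on vectors fixed by the NORMAL subgroup `N ≤ ker χ`:
`Σ_q χ(q̃)⁻¹ • ρ(q̃) (ρ h w) = χ h • Σ_q χ(q̃)⁻¹ • ρ(q̃) w` (reindex the cosets by `q ↦ q · h`).  (Private step.) [folklore] -/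
private theorem sum_apply_rho (N : Subgroup H) [N.Normal] [Fintype (H ⧸ N)] (hNχ : N ≤ χ.ker) {w : S}
    (hNw : ∀ n ∈ N, ρ n w = w) (h : H) :
    ∑ q : H ⧸ N, (((χ q.out)⁻¹ : kˣ) : k) • ρ q.out (ρ h w) =
      ((χ h : kˣ) : k) • ∑ q : H ⧸ N, (((χ q.out)⁻¹ : kˣ) : k) • ρ q.out w := by
  -- the function `z ↦ χ(z)⁻¹ • ρ(z) w` is constant on the cosets `z N`
  set φ : H → S := fun z => (((χ z)⁻¹ : kˣ) : k) • ρ z w with hφ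
  have hφN : ∀ (z : H) (n : H), n ∈ N → φ (z * n) = φ z := by
    intro z n hn
    have hχn : χ n = 1 := hNχ hn
    simp only [hφ, map_mul, hχn, mul_one, Module.End.mul_apply, hNw n hn]
  have hφout : ∀ z : H, φ ((QuotientGroup.mk z : H ⧸ N).out) = φ z := by
    intro z
    obtain ⟨n, hn⟩ := QuotientGroup.mk_out_eq_mul N z
    rw [hn]
    exact hφN z n n.2
  rw [Finset.smul_sum]
  -- left side: `χ(q̃)⁻¹ • ρ(q̃) (ρ h w) = χ h • φ (q̃ h)`
  have hL : ∀ q : H ⧸ N, (((χ q.out)⁻¹ : kˣ) : k) • ρ q.out (ρ h w) = ((χ h : kˣ) : k) • φ (q.out * h) := by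
    intro q
    show (((χ q.out)⁻¹ : kˣ) : k) • ρ q.out (ρ h w) =
      ((χ h : kˣ) : k) • ((((χ (q.out * h))⁻¹ : kˣ) : k) • ρ (q.out * h) w)
    simp only [map_mul]
    rw [Module.End.mul_apply, smul_smul, ← Units.val_mul, mul_inv_rev, mul_inv_cancel_left]
  simp_rw [hL]
  -- reindex by `q ↦ q * (mk h)` in the quotient group `H ⧸ N`
  have hre : ∀ q : H ⧸ N, φ (q.out * h) = φ ((q * (QuotientGroup.mk h : H ⧸ N)).out) := by
    intro q
    rw [← hφout (q.out * h), QuotientGroup.mk_mul, QuotientGroup.out_eq']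
  simp_rw [hre]
  exact Fintype.sum_equiv (Equiv.mulRight (QuotientGroup.mk h : H ⧸ N)) _ _ fun q => rfl

/-- the averaging sum kills the relation `ρ h w - χ h • w`.  (Private step.) [folklore] -/
private theorem sum_apply_sub_eq_zero (N : Subgroup H) [N.Normal] [Fintype (H ⧸ N)] (hNχ : N ≤ χ.ker) {w : S}
    (hNw : ∀ n ∈ N, ρ n w = w) (h : H) :
    ∑ q : H ⧸ N, (((χ q.out)⁻¹ : kˣ) : k) • ρ q.out (ρ h w - ((χ h : kˣ) : k) • w) = 0 := by
  simp only [map_sub, map_smul, smul_sub, Finset.sum_sub_distrib, sum_apply_rho ρ χ N hNχ hNw h]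
  rw [sub_eq_zero, Finset.smul_sum]
  exact Finset.sum_congr rfl fun q _ => smul_comm _ _ _

variable [CharZero k]

/-- **Algebraic survival criterion.**  If every vector of `S` is fixed by some normal subgroup of finite index of `H`
contained in `ker χ`, then a non-zero `(H, χ)`-eigenvector `v` has NON-ZERO class in the `χ`-coinvariants
`Coinv ρ χ` (characteristic `0`). [cite: BernsteinZelevinsky1976, §2.3] -/
theorem mk_ne_zero_of_eigenvector_of_forall_exists_normal
    (hN : ∀ w : S, ∃ N : Subgroup H, N.Normal ∧ N.FiniteIndex ∧ N ≤ χ.ker ∧ ∀ n ∈ N, ρ n w = w)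
    {v : S} (hv0 : v ≠ 0) (hv : ∀ h : H, ρ h v = ((χ h : kˣ) : k) • v) :
    mk ρ χ v ≠ 0 := by
  classical
  intro hmk
  have hmem : v ∈ ker ρ χ := (Submodule.Quotient.mk_eq_zero _).1 hmk
  rw [ker, Submodule.mem_span_set'] at hmem
  obtain ⟨n, f, g, hsum⟩ := hmem
  -- each generator `g i` is `ρ h_i w_i - χ h_i • w_i`
  have hg : ∀ i, ∃ hw : H × S, ρ hw.1 hw.2 - ((χ hw.1 : kˣ) : k) • hw.2 = (g i : S) := fun i => (g i).2
  choose hw hhw using hg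
  choose N hNn hNf hNχ hNw using fun i => hN (hw i).2
  obtain ⟨Nv, hNvn, hNvf, hNvχ, -⟩ := hN v
  -- a common normal finite-index subgroup inside `ker χ` fixing every `w_i`
  let N₀ : Subgroup H := Nv ⊓ ⨅ i, N i
  haveI : (⨅ i, N i).Normal :=
    ⟨fun m hm g' => Subgroup.mem_iInf.2 fun i => (hNn i).conj_mem m (Subgroup.mem_iInf.1 hm i) g'⟩
  haveI : Nv.Normal := hNvn
  haveI : N₀.Normal := Subgroup.normal_inf_normal Nv _
  haveI : Nv.FiniteIndex := hNvf
  haveI : (⨅ i, N i).FiniteIndex := Subgroup.finiteIndex_iInf fun i => hNf i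
  haveI : N₀.FiniteIndex := inferInstance
  haveI : Fintype (H ⧸ N₀) := N₀.fintypeQuotientOfFiniteIndex
  have hN₀χ : N₀ ≤ χ.ker := inf_le_left.trans hNvχ
  -- the averaging operator `A = Σ_{q ∈ H/N₀} χ(q̃)⁻¹ • ρ(q̃)`
  let A : S →ₗ[k] S := ∑ q : H ⧸ N₀, (((χ q.out)⁻¹ : kˣ) : k) • ρ q.out
  have hA : ∀ x : S, A x = ∑ q : H ⧸ N₀, (((χ q.out)⁻¹ : kˣ) : k) • ρ q.out x := fun x => by
    simp only [A, LinearMap.sum_apply, LinearMap.smul_apply]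
  have hkill : ∀ i, A (g i : S) = 0 := by
    intro i
    rw [hA, ← hhw i]
    exact sum_apply_sub_eq_zero ρ χ N₀ hN₀χ (fun m hm => hNw i m (Subgroup.mem_iInf.1 (Subgroup.mem_inf.1 hm).2 i)) (hw i).1
  have h1 : A v = 0 := by
    rw [← hsum, map_sum]
    simp only [map_smul, hkill, smul_zero, Finset.sum_const_zero]
  rw [hA, sum_apply_of_eigenvector ρ χ N₀ hv] at h1
  rcases smul_eq_zero.1 h1 with hc | hv'
  · exact (Nat.cast_ne_zero.2 Fintype.card_ne_zero) hc
  · exact hv0 hv'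

end Algebra

/-! ## §2. Topology: compact groups, smooth representations -/

section Compact

variable {k : Type*} [Field k] [CharZero k] {H : Type*} [Group H] [TopologicalSpace H] [IsTopologicalGroup H]
  [CompactSpace H] {S : Type*} [AddCommGroup S] [Module k S] (ρ : Representation k H S) (χ : H →* kˣ)

/-- **An eigenvector of a compact group survives in the twisted coinvariants.**  `H` compact, `ρ` smooth (every
vector has an open stabiliser), `ker χ` open: a non-zero `v` with `ρ h v = χ h • v` for all `h` has non-zero class
`mk ρ χ v` in `Coinv ρ χ = S ⧸ span {ρ h w - χ h • w}`.  (The open subgroup `ker χ ∩ Stab(w)` has finite index in the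
compact `H`; its normal core is the normal finite-index subgroup §1 asks for.) [cite: BernsteinZelevinsky1976, §2.3] -/
theorem mk_ne_zero_of_eigenvector (hρ : ρ.IsSmooth) (hχ : IsOpen (χ.ker : Set H)) {v : S} (hv0 : v ≠ 0)
    (hv : ∀ h : H, ρ h v = ((χ h : kˣ) : k) • v) : mk ρ χ v ≠ 0 := by
  refine mk_ne_zero_of_eigenvector_of_forall_exists_normal ρ χ (fun w => ?_) hv0 hv
  -- the open subgroup `ker χ ⊓ Stab(w)` has finite index; take its normal core
  set K : Subgroup H := χ.ker ⊓ ρ.stabilizerSubgroup w with hK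
  have hKo : IsOpen (K : Set H) := hχ.inter (hρ w)
  haveI : Finite (H ⧸ K) := Subgroup.quotient_finite_of_isOpen K hKo
  haveI : K.FiniteIndex := Subgroup.finiteIndex_of_finite_quotient
  refine ⟨K.normalCore, inferInstance, inferInstance, (Subgroup.normalCore_le K).trans inf_le_left, fun n hn => ?_⟩
  exact (ρ.mem_stabilizerSubgroup w n).1 (Subgroup.mem_inf.1 (Subgroup.normalCore_le K hn)).2

/-- **Invariant vectors of a compact group survive in the coinvariants**: `H` compact, `ρ` smooth, `χ` trivial on
`H`-translates as read by `v` — precisely: `χ = 1` on `H` (open kernel trivially) and `v` fixed — then `mk ρ χ v ≠ 0` for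
`v ≠ 0`.  Stated for a character `χ` with `∀ h, χ h = 1` (the unramified local character of the consumer).
[cite: BernsteinZelevinsky1976, §2.3] -/
theorem mk_ne_zero_of_mem_invariants (hρ : ρ.IsSmooth) (hχ : ∀ h : H, χ h = 1) {v : S} (hv0 : v ≠ 0)
    (hv : ∀ h : H, ρ h v = v) : mk ρ χ v ≠ 0 := by
  have hker : (χ.ker : Set H) = Set.univ := Set.eq_univ_of_forall fun h => (MonoidHom.mem_ker).2 (hχ h)
  refine mk_ne_zero_of_eigenvector ρ χ hρ (by rw [hker]; exact isOpen_univ) hv0 fun h => ?_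
  rw [hv h, hχ h, Units.val_one, one_smul]

end Compact

end Literature.RepresentationTheory.TwistedCoinv
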